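import Summits.QuantumFields.BalabanUV.T4Continuum.Support.NE7FlatInteriorCoreDivForm
import HarnessLib

/-!
# NE7FlatInteriorGradientDivForm — THE FLAT INTERIOR C¹ LETTER FOR THE LATTICE POISSON PROBLEM WITH A DIVERGENCE-FORM SOURCE (scalar core):
# `Δu = Σ_μ ∇_μ⁻ q_μ + r` and `|u| ≤ A` on `cube x (3m)` ⟹ `|u(x+e_j) − u(x)| ≤ C(d)·[(1 + log⁺(3m))·sup|q| + m·sup|r| + A∕m]`

Cell `pub-balaban`, rung (B)+1 sub-cell t4; row-NE7b owner lineage `b2b-balaban-t4-ne7b-p1` (gen 155), JUNCTION SERVICE for row NE7's next supplier stub (S-h)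
(t4-ne7-p1 g108, [NE7P1-G108-INBOX-1] (4)(b): «a FLAT INTERIOR C¹ LETTER FOR THE 2-FORM∕SCALAR POISSON PROBLEM at scale R … a LOG IS AFFORDABLE»; my pricing
[NE7bP1-G155-INBOX-4] (2)).  THIS FILE is the scalar real-valued core over pv23's `Beta/PoissonInterior` (`Site d = ℤ^d`, `cube`, `nrm`, `G₀`, `dG₀`, the C¹ spline
`cutoff m x`, `green_rep`∕`rep_increment`, `core_bound`∕`interior_estimate`); the matrix∕2-form and cube-geometry corollaries are a separate file.
THE POINT.  pv23's `interior_estimate` charges the source through `m·sup|Δu|`; when the source is a lattice DIVERGENCE `Σ_μ (q(y,μ) − q(y−e_μ,μ))` the difference is moved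
onto the kernel by one summation by parts (`sum_shift`): `Σ_y Φ(x−y)χ(y)(q(y,μ) − q(y−e_μ,μ)) = Σ_y [Φ(x−y)χ(y) − Φ(x−y−e_μ)χ(y+e_μ)]·q(y,μ)`, and
`|Φ(x−y)χ(y) − Φ(x−y−e_μ)χ(y+e_μ)| ≤ E₁nrm(x−y)^{−(p+1)} + 2^pE₀nrm(x−y)^{−p}·4∕m`; for `Φ = ∇_jG₀` (`p = d−1`) the first sum is the LOGARITHM `Σ_{cube 0 (3m)} nrm^{−d} ≤
1 + 2d3^{d−1}(1 + log⁺(3m))` (gen 154's `NE7FlatGradientLetterBlockDiv.sum_cube_inv_nrm_pow_d_le`) and the second is `O(1)`; the `r` part is pv23's `m·sup|r|`; the cutoff part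
is pv23's verbatim (`B∕m^{d+1}` with `B = Σ_{cube}|u| ≤ (6m+1)^d·A`, i.e. `A∕m`).
WHAT ([folklore]; 0 def, 0 sorry; the core bound `core_bound_divForm` is file 1∕2 `NE7FlatInteriorCoreDivForm`).  `sum_abs_le_card_mul`, **`interior_gradient_divForm`** — `∃ C = C(d) ≥ 0, ∀ m ≥ 1, ∀ u q r x Qs Rs A`: if `Δu(y) = Σ_μ (q y μ − q (y − e_μ) μ) + r y`, `|q y μ| ≤ Qs`, `|r y| ≤ Rs`, `|u y| ≤ A` for
`y ∈ cube x (3m)` then `∀ j, |u (x + e_j) − u x| ≤ C·((1 + log⁺(3m))·Qs + m·Rs + A∕m)` (`d ≥ 3`; `log⁺ = Real.posLog`).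
HONEST FRAMING (page 1): flat `ℤ^d` potential theory, [folklore]; constants inherit lit1's existential Green-function constants (k-uniform, not numeric); nothing of Bałaban's
asserted; the covariant assembly (S-h)(c) and the tension letter (S-h)(a) are the road's; (10) TYPE is NOT proved here; NE3∕NE7 NOT proved; row NE7b NOT PRINTED ∕ NOT PROVED; spine
count = dagwriter's call; finite T⁴ rung (B)+1 — NOT infinite volume, NOT mass gap, NOT BetaPertH, NOT Clay.
-/

set_option autoImplicit false

open scoped BigOperators
open Finset Real

namespace Summit.QuantumFields.BalabanUV.T4Continuum.NE7FlatInteriorGradientDivForm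

open Literature.MathematicalPhysics.QuantumFieldTheory.Balaban1983to89
open B7Prop1Explicit (Site)
open Literature.Probability.LatticeModels (latticeLaplacianZd)
open Beta.PoissonInterior (cube mem_cube cube_mono supNorm supNorm_neg supNorm_single_one nrm nrm_pos G₀ dG₀ G₀_diff_bound G₀_diff2_bound
  sum_cube_inv_nrm_pow_le sum_shift cutoff cutoff_eq_zero_of_not_mem abs_cutoff_le_one cutoff_diff_le cutoff_diff2_le cutoff_shift_eq_one
  add_mem_cube_succ sub_mem_cube_succ le_supNorm_of half_le_nrm half_le_nrm_add inv_nrm_pow_le nrm_shift_ge_half sum_cube_reflect lap_mul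
  rep_increment)
open NE7FlatGradientLetterBlockDiv (sum_cube_inv_nrm_pow_d_le)
open NE7FlatInteriorCoreDivForm (core_bound_divForm)

noncomputable section

variable {d : ℕ}

/-! ## The interior gradient letter with a divergence-form source -/

/-- the ℓ¹ mass of a function bounded by `A` on `cube x (3m)` is at most `(6m+1)^d·A ≤ 7^d·m^d·A`. [folklore] -/
theorem sum_abs_le_card_mul {m : ℕ} (hm : 1 ≤ m) (u : Site d → ℝ) (x : Site d) {A : ℝ}
    (hA : ∀ y ∈ cube x (3 * m), |u y| ≤ A) :
    ∑ y ∈ cube x (3 * m), |u y| ≤ (7 : ℝ) ^ d * (m : ℝ) ^ d * A := by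
  have hA0 : 0 ≤ A := le_trans (abs_nonneg _) (hA x (by rw [mem_cube]; intro i; simp))
  have hcard : ((cube x (3 * m)).card : ℝ) ≤ (7 : ℝ) ^ d * (m : ℝ) ^ d := by
    have h1 : (cube x (3 * m)).card = (2 * (3 * m) + 1) ^ d := by
      unfold Beta.PoissonInterior.cube
      rw [Fintype.card_piFinset]
      have hI : ∀ i : Fin d, (Finset.Icc (x i - ((3 * m : ℕ) : ℤ)) (x i + ((3 * m : ℕ) : ℤ))).card = 2 * (3 * m) + 1 := by
        intro i
        rw [Int.card_Icc]
        have e : x i + ((3 * m : ℕ) : ℤ) + 1 - (x i - ((3 * m : ℕ) : ℤ)) = ((2 * (3 * m) + 1 : ℕ) : ℤ) := by push_cast; ring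
        rw [e, Int.toNat_natCast]
      simp only [hI, Finset.prod_const, Finset.card_univ, Fintype.card_fin]
    have hm1 : (1 : ℝ) ≤ m := by exact_mod_cast hm
    have h7 : (2 * (3 * (m : ℝ)) + 1) ≤ 7 * m := by linarith
    rw [h1]; push_cast
    rw [← mul_pow]
    exact pow_le_pow_left₀ (by positivity) h7 d
  calc ∑ y ∈ cube x (3 * m), |u y| ≤ ∑ _y ∈ cube x (3 * m), A := Finset.sum_le_sum hA
    _ = (cube x (3 * m)).card * A := by rw [Finset.sum_const, nsmul_eq_mul]
    _ ≤ (7 : ℝ) ^ d * (m : ℝ) ^ d * A := mul_le_mul_of_nonneg_right hcard hA0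

set_option maxHeartbeats 400000 in
/-- **THE FLAT INTERIOR C¹ LETTER WITH A DIVERGENCE-FORM SOURCE** (`d ≥ 3`): there is `C = C(d) ≥ 0` such that for every `m ≥ 1`, `u, q, r : ℤ^d → ℝ` (`q` a bond
function), `x`, and `Qs, Rs, A ≥ 0`: if on `cube x (3m)` `Δu(y) = Σ_μ (q(y,μ) − q(y−e_μ,μ)) + r(y)`, `|q(y,μ)| ≤ Qs`, `|r(y)| ≤ Rs`, `|u(y)| ≤ A`, then for every `j`
`|u(x + e_j) − u(x)| ≤ C·((1 + log⁺(3m))·Qs + m·Rs + A∕m)` — the divergence costs a LOGARITHM, the zeroth-order source a factor `m`, the size of `u` a factor `1∕m`.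
(pv23's `rep_increment` + `core_bound_divForm` at `Φ = ∇_jG₀`, `p = d−1`, `E₀ = C₁`, `E₁ = 2^dC₂`; the log = `sum_cube_inv_nrm_pow_d_le`.) [folklore] -/
theorem interior_gradient_divForm (hd : 3 ≤ d) : ∃ C : ℝ, 0 ≤ C ∧ ∀ (m : ℕ), 1 ≤ m →
    ∀ (u : Site d → ℝ) (q : Site d → Fin d → ℝ) (r : Site d → ℝ) (x : Site d) (Qs Rs A : ℝ), 0 ≤ Qs → 0 ≤ Rs → 0 ≤ A →
    (∀ y ∈ cube x (3 * m), latticeLaplacianZd u y = (∑ μ : Fin d, (q y μ - q (y - Pi.single μ 1) μ)) + r y) →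
    (∀ y ∈ cube x (3 * m), ∀ μ : Fin d, |q y μ| ≤ Qs) → (∀ y ∈ cube x (3 * m), |r y| ≤ Rs) →
    (∀ y ∈ cube x (3 * m), |u y| ≤ A) →
    ∀ j : Fin d, |u (x + Pi.single j 1) - u x| ≤ C * ((1 + Real.posLog ((3 * m : ℕ) : ℝ)) * Qs + (m : ℝ) * Rs + A / m) := by
  have hd0 : 0 < d := by omega
  obtain ⟨C₁, hC₁, hG1⟩ := G₀_diff_bound hd
  obtain ⟨C₂, hC₂, hG2⟩ := G₀_diff2_bound hd
  -- the three constants: log term, linear terms, cutoff term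
  set Klog : ℝ := d * (2 ^ d * C₂) * (1 + 2 * d * 3 ^ (d - 1)) with hKlog
  set Klin : ℝ := (d * (4 * 2 ^ (d - 1) * C₁) + C₁) * (1 + 2 * d * 3 ^ (d - 1) * 3) with hKlin
  set Kcut : ℝ := (7 : ℝ) ^ d * (d * (2 * (2 ^ d * C₂) * 2 ^ (d - 1 + 1) * 4 + C₁ * 2 ^ (d - 1) * 4)) with hKcut
  have hKlog0 : 0 ≤ Klog := by positivity
  have hKlin0 : 0 ≤ Klin := by positivity
  have hKcut0 : 0 ≤ Kcut := by positivity
  refine ⟨Klog + Klin + Kcut, by positivity, ?_⟩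
  intro m hm u q r x Qs Rs A hQs hRs hA0 hdiv hq hr hA j
  have hm0 : (0 : ℝ) < m := by exact_mod_cast hm
  have hm1 : (1 : ℝ) ≤ m := by exact_mod_cast hm
  -- the kernel `∇ⱼG₀` and its envelopes (`p = d − 1`)
  have hH0 : ∀ v, |dG₀ j v| ≤ C₁ / nrm v ^ (d - 1) := fun v => (hG1 v j).1
  have hH1 : ∀ v (i : Fin d), |dG₀ j (v + Pi.single i 1) - dG₀ j v| ≤ 2 ^ d * C₂ / nrm v ^ (d - 1 + 1) ∧
      |dG₀ j (v - Pi.single i 1) - dG₀ j v| ≤ 2 ^ d * C₂ / nrm v ^ (d - 1 + 1) := by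
    intro v i
    have e : d - 1 + 1 = d := by omega
    rw [e]
    constructor
    · have h := hG2 v j i
      have eq : dG₀ j (v + Pi.single i 1) - dG₀ j v =
          G₀ (v + Pi.single i 1 + Pi.single j 1) - G₀ (v + Pi.single i 1) - G₀ (v + Pi.single j 1) + G₀ v := by
        unfold Beta.PoissonInterior.dG₀; ring
      rw [eq]
      refine h.trans ?_
      apply div_le_div_of_nonneg_right _ (pow_nonneg (nrm_pos v).le _)
      have : (1 : ℝ) ≤ 2 ^ d := one_le_pow₀ (by norm_num)
      nlinarith
    · have h := hG2 (v - Pi.single i 1) j i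
      have eq : dG₀ j (v - Pi.single i 1) - dG₀ j v =
          -(G₀ (v - Pi.single i 1 + Pi.single i 1 + Pi.single j 1) - G₀ (v - Pi.single i 1 + Pi.single i 1)
            - G₀ (v - Pi.single i 1 + Pi.single j 1) + G₀ (v - Pi.single i 1)) := by
        unfold Beta.PoissonInterior.dG₀; rw [sub_add_cancel]; ring
      rw [eq, abs_neg]
      refine h.trans ?_
      have hhalf : nrm v / 2 ≤ nrm (v - Pi.single i 1) := by
        rw [sub_eq_add_neg]
        exact nrm_shift_ge_half v _ (by rw [supNorm_neg]; exact supNorm_single_one i)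
      have hpos := nrm_pos (v - Pi.single i 1)
      have hposv := nrm_pos v
      rw [div_le_div_iff₀ (pow_pos hpos d) (pow_pos hposv d)]
      calc C₂ * nrm v ^ d = C₂ * ((nrm v / 2) ^ d * 2 ^ d) := by
            rw [div_pow, div_mul_cancel₀ _ (by positivity)]
        _ ≤ C₂ * (nrm (v - Pi.single i 1) ^ d * 2 ^ d) := by
            apply mul_le_mul_of_nonneg_left _ hC₂
            apply mul_le_mul_of_nonneg_right _ (by positivity)
            exact pow_le_pow_left₀ (by positivity) hhalf d
        _ = 2 ^ d * C₂ * nrm (v - Pi.single i 1) ^ d := by ring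
  have hB := sum_abs_le_card_mul hm u x hA
  have hcore := core_bound_divForm hm (dG₀ j) hC₁ (by positivity : (0 : ℝ) ≤ 2 ^ d * C₂) hH0 hH1 u q r x hdiv hq hr hB
  -- the three lattice sums
  have hSd : ∑ z ∈ cube (0 : Site d) (3 * m), 1 / nrm z ^ (d - 1 + 1) ≤ (1 + 2 * d * 3 ^ (d - 1)) * (1 + Real.posLog ((3 * m : ℕ) : ℝ)) := by
    have e : d - 1 + 1 = d := by omega
    rw [e]
    have h := sum_cube_inv_nrm_pow_d_le (d := d) hd0 (3 * m)
    have hpl : 0 ≤ Real.posLog ((3 * m : ℕ) : ℝ) := Real.posLog_nonneg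
    have hK : (0 : ℝ) ≤ 2 * d * 3 ^ (d - 1) := by positivity
    nlinarith
  have hSd1 : ∑ z ∈ cube (0 : Site d) (3 * m), 1 / nrm z ^ (d - 1) ≤ (1 + 2 * d * 3 ^ (d - 1) * 3) * (m : ℝ) := by
    have h := sum_cube_inv_nrm_pow_le hd0 (3 * m) (d - 1) le_rfl
    have e : d - (d - 1) = 1 := by omega
    rw [e, pow_one] at h
    have hK : (0 : ℝ) ≤ 2 * d * 3 ^ (d - 1) * 3 := by positivity
    calc _ ≤ 1 + 2 * d * 3 ^ (d - 1) * ((3 * m : ℕ) : ℝ) := h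
      _ = 1 + 2 * d * 3 ^ (d - 1) * 3 * (m : ℝ) := by push_cast; ring
      _ ≤ (m : ℝ) + 2 * d * 3 ^ (d - 1) * 3 * (m : ℝ) := by linarith
      _ = (1 + 2 * d * 3 ^ (d - 1) * 3) * (m : ℝ) := by ring
  have hrep := rep_increment hd hm u x j
  have e2 : d - 1 + 2 = d + 1 := by omega
  rw [e2] at hcore
  rw [hrep, abs_neg]
  refine hcore.trans ?_
  -- bound the three groups
  set Lg : ℝ := 1 + Real.posLog ((3 * m : ℕ) : ℝ) with hLg
  have hLg1 : 1 ≤ Lg := by rw [hLg]; have := Real.posLog_nonneg (x := ((3 * m : ℕ) : ℝ)); linarith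
  set S₀ := ∑ z ∈ cube (0 : Site d) (3 * m), 1 / nrm z ^ (d - 1) with hS₀
  set S₁ := ∑ z ∈ cube (0 : Site d) (3 * m), 1 / nrm z ^ (d - 1 + 1) with hS₁
  have hS₀0 : 0 ≤ S₀ := Finset.sum_nonneg fun z _ => by have := nrm_pos z; positivity
  -- (i) the `Qs` group: `d·Qs·(2^dC₂·S₁ + 4·2^{d−1}·C₁·S₀/m) ≤ (Klog + part of Klin)·Lg·Qs`
  have hq1 : d * Qs * (2 ^ d * C₂ * S₁ + 4 * 2 ^ (d - 1) * C₁ * S₀ / m) ≤ (Klog + d * (4 * 2 ^ (d - 1) * C₁) * (1 + 2 * d * 3 ^ (d - 1) * 3)) * (Lg * Qs) := by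
    have h1 : 2 ^ d * C₂ * S₁ ≤ 2 ^ d * C₂ * ((1 + 2 * d * 3 ^ (d - 1)) * Lg) := mul_le_mul_of_nonneg_left hSd (by positivity)
    have h2 : 4 * 2 ^ (d - 1) * C₁ * S₀ / m ≤ 4 * 2 ^ (d - 1) * C₁ * (1 + 2 * d * 3 ^ (d - 1) * 3) := by
      rw [div_le_iff₀ hm0]
      calc 4 * 2 ^ (d - 1) * C₁ * S₀ ≤ 4 * 2 ^ (d - 1) * C₁ * ((1 + 2 * d * 3 ^ (d - 1) * 3) * (m : ℝ)) := mul_le_mul_of_nonneg_left hSd1 (by positivity)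
        _ = _ := by ring
    have h3 : 4 * 2 ^ (d - 1) * C₁ * (1 + 2 * d * 3 ^ (d - 1) * 3) ≤ 4 * 2 ^ (d - 1) * C₁ * (1 + 2 * d * 3 ^ (d - 1) * 3) * Lg := by
      have h0 : 0 ≤ 4 * 2 ^ (d - 1) * C₁ * (1 + 2 * d * 3 ^ (d - 1) * 3) := by positivity
      nlinarith
    have hdQ : 0 ≤ (d : ℝ) * Qs := by positivity
    calc d * Qs * (2 ^ d * C₂ * S₁ + 4 * 2 ^ (d - 1) * C₁ * S₀ / m)
        ≤ d * Qs * (2 ^ d * C₂ * ((1 + 2 * d * 3 ^ (d - 1)) * Lg) + 4 * 2 ^ (d - 1) * C₁ * (1 + 2 * d * 3 ^ (d - 1) * 3) * Lg) :=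
          mul_le_mul_of_nonneg_left (add_le_add h1 (h2.trans h3)) hdQ
      _ = _ := by rw [hKlog]; ring
  -- (ii) the `Rs` group
  have hr1 : Rs * (C₁ * S₀) ≤ C₁ * (1 + 2 * d * 3 ^ (d - 1) * 3) * ((m : ℝ) * Rs) := by
    calc Rs * (C₁ * S₀) ≤ Rs * (C₁ * ((1 + 2 * d * 3 ^ (d - 1) * 3) * (m : ℝ))) :=
          mul_le_mul_of_nonneg_left (mul_le_mul_of_nonneg_left hSd1 hC₁) hRs
      _ = _ := by ring
  -- (iii) the cutoff group: `B ≤ 7^d m^d A`, `m^d/m^{d+1} = 1/m`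
  have hc1 : (7 : ℝ) ^ d * (m : ℝ) ^ d * A * (d * ((2 * (2 ^ d * C₂) * 2 ^ (d - 1 + 1) * 4 + C₁ * 2 ^ (d - 1) * 4) / (m : ℝ) ^ (d + 1)))
      = Kcut * (A / m) := by
    rw [hKcut, pow_succ]; field_simp; ring
  calc d * Qs * (2 ^ d * C₂ * S₁ + 4 * 2 ^ (d - 1) * C₁ * S₀ / ↑m) + Rs * (C₁ * S₀) +
        (7 : ℝ) ^ d * (m : ℝ) ^ d * A * (d * ((2 * (2 ^ d * C₂) * 2 ^ (d - 1 + 1) * 4 + C₁ * 2 ^ (d - 1) * 4) / (m : ℝ) ^ (d + 1)))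
      ≤ (Klog + d * (4 * 2 ^ (d - 1) * C₁) * (1 + 2 * d * 3 ^ (d - 1) * 3)) * (Lg * Qs) + C₁ * (1 + 2 * d * 3 ^ (d - 1) * 3) * ((m : ℝ) * Rs) + Kcut * (A / m) := by
        rw [hc1]; exact add_le_add (add_le_add hq1 hr1) le_rfl
    _ ≤ (Klog + Klin + Kcut) * (Lg * Qs) + (Klog + Klin + Kcut) * ((m : ℝ) * Rs) + (Klog + Klin + Kcut) * (A / m) := by
        have hKlin' : Klin = d * (4 * 2 ^ (d - 1) * C₁) * (1 + 2 * d * 3 ^ (d - 1) * 3) + C₁ * (1 + 2 * d * 3 ^ (d - 1) * 3) := by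
          rw [hKlin]; ring
        have hx1 : 0 ≤ C₁ * (1 + 2 * (d : ℝ) * 3 ^ (d - 1) * 3) := by positivity
        have hx2 : 0 ≤ (d : ℝ) * (4 * 2 ^ (d - 1) * C₁) * (1 + 2 * d * 3 ^ (d - 1) * 3) := by positivity
        have t1 : (Klog + d * (4 * 2 ^ (d - 1) * C₁) * (1 + 2 * d * 3 ^ (d - 1) * 3)) ≤ Klog + Klin + Kcut := by
          rw [hKlin']; linarith
        have t2 : C₁ * (1 + 2 * d * 3 ^ (d - 1) * 3) ≤ Klog + Klin + Kcut := by
          rw [hKlin']; linarith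
        have t3 : Kcut ≤ Klog + Klin + Kcut := by linarith
        exact add_le_add (add_le_add (mul_le_mul_of_nonneg_right t1 (by positivity)) (mul_le_mul_of_nonneg_right t2 (by positivity)))
          (mul_le_mul_of_nonneg_right t3 (by positivity))
    _ = (Klog + Klin + Kcut) * (Lg * Qs + (m : ℝ) * Rs + A / m) := by ring

end

end Summit.QuantumFields.BalabanUV.T4Continuum.NE7FlatInteriorGradientDivForm
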